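import Summits.NavierStokesRegularity.NavierStokesRegularity.Theorems.CorkscrewDynamoCorkscrewProfileRssCoRotation
import Summits.NavierStokesRegularity.NavierStokesRegularity.Theorems.CorkscrewDynamoCorkscrewProfileTypeIDerivativeDecay
import Summits.NavierStokesRegularity.NavierStokesRegularity.Theorems.CorkscrewDynamoCorkscrewProfileRotatedVorticityEq
import Summits.NavierStokesRegularity.NavierStokesRegularity.Theorems.CorkscrewDynamoCorkscrewProfileVerticalVorticityDivergenceForm
import Summits.NavierStokesRegularity.NavierStokesRegularity.Theorems.CorkscrewDynamoCorkscrewProfileVerticalVorticityFluxIntegrable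
import Literature.Analysis.FluidPDE.PineauVicolEnstrophy
import Literature.Analysis.FluidPDE.PineauVicolWeightPositivity
import Literature.Analysis.FluidPDE.VorticityCalculus
import HarnessLib

/-!
# Route CorkscrewDynamo · crux `CorkscrewProfile` (stmt-NavierStokesRegularity-11282) — STRICT CO-ROTATION:
# the vertical vorticity of a rotated Leray profile changes sign, and enters the open co-rotation ball

Line `registered` (= `Cruxes/CorkscrewProfile/Lines/birth.lean`, skeleton v13), lead c6 (2026-08-17): assembly of the tool
stubs V1 `stub_rotatedVorticityEq`, V2 `stub_verticalVorticityDivergenceForm`, V3 `stub_verticalVorticityFluxIntegrable`,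
V4 `stub_typeIDerivativeDecay` into the registered theorems A1 `rotatedLerayProfile_eq_zero_of_cyclonic`,
A2 `rotatedLerayProfile_eq_zero_of_offBall`, A3 `rssProfileExists_enters_corotationBall`.

THE IDENTITY. For a smooth solution `(U, P)` of Perelman's rotated Leray profile system
`α(JU − DU[Jy]) + ½U + ½DU[y] − ΔU + DU[U] + ∇P = 0`, `div U = 0` (`J = rotGen = e₃ × ·`), the `e₃`-component of the
vorticity equation (V1) reads `Δω₃ = Dω₃[b] + ω₃ − DU[ω]₃`, `b := U + ½y − αJy` — the Coriolis term `αJω` is horizontal —,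
i.e. in divergence form (V2, `div b = 3/2`, `div ω = 0`)

  `½ ω₃ = div F`,   `F := ω₃ b − ∇ω₃ − U₃ ω`.

Under the Type-I derivative decay `‖DU‖ ≲ (1+|y|)⁻²`, `‖D curl U‖ ≲ (1+|y|)⁻³` (automatic for RSS data, V4) the flux has
`‖F‖/(1+|y|) ∈ L¹` as soon as `ω₃ ∈ L¹` (V3), so `∫ ω₃ = 0` (`integral_divergence_eq_zero_of_integrable_div`).

REMARK (what the identity is). In physical variables `∫ ω dx` is conserved by smooth decaying Navier–Stokes flows and has
scaling weight `−1` (`ω_λ(x,t) = λ²ω(λx, λ²t)`), so the total vorticity of every (rotated, discretely) self-similar solution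
with integrable vorticity vanishes; `∫ ω₃ = 0` for the profile is the similarity-variables shadow of that fact. The profile-level
proof given here is self-contained, supplies the exact decay bookkeeping under which it holds (V3/V4), and — the point — in the
co-rotation-sphere case integrability comes for free (`ω₃ = |ω|²/(2α) = O(|y|⁻⁴)`), which is what closes A2.

CONSEQUENCES. (A1) a CYCLONIC profile (`α ω₃ ≥ 0` everywhere) with `ω₃ ∈ L¹` is trivial (then `α ω₃ ≡ 0` and lead c5's
co-rotation theorem T7 applies); with T7 (`α ω₃ ≤ 0 ⇒ U ≡ 0`): the vertical vorticity of a nontrivial profile CHANGES SIGN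
unless its cyclonic tail is non-integrable. (A2) vorticity avoiding the OPEN co-rotation ball `B(αe₃, |α|)` forces `U ≡ 0`:
by c5's sphere rigidity (here with polynomial pressure) the vorticity then lies ON the sphere, where `ω₃ = |ω|²/(2α)` is
cyclonic and `O(|y|⁻⁴)`. (A3) every witness of `RssProfileExists` (stmt-NavierStokesRegularity-16274) has vorticity STRICTLY
inside `B(αe₃, |α|)` somewhere, and its vertical vorticity changes sign or is non-integrable.
-/

noncomputable section

open MeasureTheory Set Function Filter Topology InnerProductSpace Metric
open Literature.Analysis.FluidPDE Literature.Analysis.FluidPDE.PineauVicol2026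
open scoped RealInnerProductSpace Laplacian ContDiff NNReal ENNReal

namespace Summit.NavierStokesRegularity.NavierStokesRegularity.Theorems.CorkscrewProfile.Birth

set_option linter.dupNamespace false

/-! ### Co-rotation sphere rigidity with polynomially bounded pressure -/

/-- **Co-rotation sphere rigidity, polynomial pressure.** If the vorticity of a smooth rotated Leray profile (Type-I profile
decay, `|P y| ≤ M(1+‖y‖)^N`) never enters the OPEN co-rotation ball `B(αe₃, |α|)`, i.e. `2α (curl U)₃ ≤ |curl U|²` everywhere,
then it lies ON the sphere everywhere: `|curl U|² ≡ 2α (curl U)₃` (the gauged head is a polynomially bounded subsolution, hence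
constant — `rotatedHead_source_eq_zero_of_nonneg` —, and its source `|curl U|² − 2α(curl U)₃` vanishes; c5's
`rotatedLerayProfile_vorticity_on_corotationSphere` is the case `N = 0`). [cite: Tsai1998, Lemma 5.1 and (1.7) (the case α = 0)] -/
theorem rotatedLerayProfile_vorticity_on_corotationSphere_poly {α C₀ M : ℝ} {N : ℕ}
    {U : EuclideanSpace ℝ (Fin 3) → EuclideanSpace ℝ (Fin 3)} {P : EuclideanSpace ℝ (Fin 3) → ℝ}
    (hU : ContDiff ℝ (⊤ : ℕ∞) U) (hP : ContDiff ℝ (⊤ : ℕ∞) P) (hdiv : VectorCalculus.IsDivFree U)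
    (heq : ∀ y : EuclideanSpace ℝ (Fin 3),
      α • (rotGen (U y) - fderiv ℝ U y (rotGen y)) + (1 / 2 : ℝ) • U y + (1 / 2 : ℝ) • fderiv ℝ U y y
        - (Δ U) y + fderiv ℝ U y (U y) + gradient P y = 0)
    (hdec : ∀ y : EuclideanSpace ℝ (Fin 3), ‖U y‖ ≤ C₀ / (1 + ‖y‖))
    (hPM : ∀ y : EuclideanSpace ℝ (Fin 3), |P y| ≤ M * (1 + ‖y‖) ^ N)
    (hball : ∀ y : EuclideanSpace ℝ (Fin 3), 2 * α * (curl U y) 2 ≤ ‖curl U y‖ ^ 2) :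
    ∀ y : EuclideanSpace ℝ (Fin 3), ‖curl U y‖ ^ 2 = 2 * α * (curl U y) 2 := by
  obtain ⟨-, hUb, -⟩ := bounds_of_profile_decay hdec
  have hU3 : ContDiff ℝ 3 U := hU.of_le (WithTop.coe_le_coe.2 le_top)
  have hP2 : ContDiff ℝ 2 P := hP.of_le (WithTop.coe_le_coe.2 le_top)
  have hUd : Differentiable ℝ U := hU.differentiable (by simp)
  have hcurl : ∀ y, ‖curl U y‖ ^ 2 = 2⁻¹ * frobeniusNormSq (spin U y) := fun y =>
    norm_curl_sq_eq_frobeniusNormSq_spin_holds U y (hUd y)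
  have hsrc' : ∀ y, (1 : ℝ) / 2 * frobeniusNormSq (spin U y) + 2 * 1 * traceCLM ((α • rotGenL).comp (fderiv ℝ U y)) =
      ‖curl U y‖ ^ 2 - 2 * α * (curl U y) 2 := fun y => by
    rw [traceCLM_smul_rotGenL_comp_fderiv, hcurl y]
    ring
  have hsrc : ∀ y, 0 ≤ (1 : ℝ) / 2 * frobeniusNormSq (spin U y) + 2 * 1 * traceCLM ((α • rotGenL).comp (fderiv ℝ U y)) :=
    fun y => by rw [hsrc' y]; linarith [hball y]
  obtain ⟨hzero, -⟩ := rotatedHead_source_eq_zero_of_nonneg one_pos (by norm_num : (0 : ℝ) < 1 / 2) (α • rotGenL)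
    (inner_smul_rotGenL_skew α) hU3 hP2 hdiv (rotatedProfile_eq_general heq) hUb hPM hsrc
  intro y
  have h := hzero y
  rw [hsrc' y] at h
  linarith

/-! ### A1: cyclonic profiles with integrable vertical vorticity are trivial -/

/-- The vertical-vorticity flux `F := ω₃ b − ∇ω₃ − U₃ ω` (`ω = curl U`, `b = U + ½y − αJy`) is `C¹` for `U ∈ C³`.
[folklore] -/
theorem contDiff_verticalVorticityFlux {α : ℝ} {U : EuclideanSpace ℝ (Fin 3) → EuclideanSpace ℝ (Fin 3)}
    (hU3 : ContDiff ℝ 3 U) :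
    ContDiff ℝ 1 (fun z : EuclideanSpace ℝ (Fin 3) =>
      (curl U z 2) • (U z + (1 / 2 : ℝ) • z - α • rotGen z) - gradient (fun w => curl U w 2) z - (U z 2) • curl U z) := by
  have hω2 : ContDiff ℝ 2 (curl U) := contDiff_curl (n := 2) (by exact_mod_cast hU3)
  have hω1 : ContDiff ℝ 1 (curl U) := hω2.of_le (by norm_num)
  have hω₃2 : ContDiff ℝ 2 (fun w => curl U w 2) :=
    (EuclideanSpace.proj (2 : Fin 3) : EuclideanSpace ℝ (Fin 3) →L[ℝ] ℝ).contDiff.comp hω2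
  have hω₃1 : ContDiff ℝ 1 (fun w => curl U w 2) := hω₃2.of_le (by norm_num)
  have hgrad : ContDiff ℝ 1 (gradient (fun w => curl U w 2)) :=
    Literature.Analysis.FluidPDE.contDiff_gradient (n := 1) (by exact_mod_cast hω₃2)
  have hU1 : ContDiff ℝ 1 U := hU3.of_le (by norm_num)
  have hU₃1 : ContDiff ℝ 1 (fun z => U z 2) :=
    (EuclideanSpace.proj (2 : Fin 3) : EuclideanSpace ℝ (Fin 3) →L[ℝ] ℝ).contDiff.comp hU1
  have hrot : ContDiff ℝ 1 (fun z : EuclideanSpace ℝ (Fin 3) => rotGen z) := by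
    have : (fun z : EuclideanSpace ℝ (Fin 3) => rotGen z) = fun z => rotGenL z := by
      funext z; rw [rotGenL_apply]
    rw [this]
    exact rotGenL.contDiff
  have hb : ContDiff ℝ 1 (fun z : EuclideanSpace ℝ (Fin 3) => U z + (1 / 2 : ℝ) • z - α • rotGen z) :=
    (hU1.add (contDiff_id.const_smul _)).sub (hrot.const_smul _)
  exact ((hω₃1.smul hb).sub hgrad).sub (hU₃1.smul hω1)

/-- **The vertical-vorticity flux identity**: for a smooth rotated Leray profile, `div F = ½ ω₃` pointwise, where
`F := ω₃ b − ∇ω₃ − U₃ ω`, `b = U + ½y − αJy` (V2, and the `e₃`-component of the vorticity equation V1, in which the Coriolis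
term `αJω` has no vertical component). [folklore] -/
theorem divergence_verticalVorticityFlux {α : ℝ}
    {U : EuclideanSpace ℝ (Fin 3) → EuclideanSpace ℝ (Fin 3)} {P : EuclideanSpace ℝ (Fin 3) → ℝ}
    (hU : ContDiff ℝ (⊤ : ℕ∞) U) (hP : ContDiff ℝ (⊤ : ℕ∞) P) (hdiv : VectorCalculus.IsDivFree U)
    (heq : ∀ y : EuclideanSpace ℝ (Fin 3),
      α • (rotGen (U y) - fderiv ℝ U y (rotGen y)) + (1 / 2 : ℝ) • U y + (1 / 2 : ℝ) • fderiv ℝ U y y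
        - (Δ U) y + fderiv ℝ U y (U y) + gradient P y = 0)
    (y : EuclideanSpace ℝ (Fin 3)) :
    VectorCalculus.divergence
        (fun z => (curl U z 2) • (U z + (1 / 2 : ℝ) • z - α • rotGen z)
          - gradient (fun w => curl U w 2) z - (U z 2) • curl U z) y = (1 / 2 : ℝ) * curl U y 2 := by
  have hU3 : ContDiff ℝ 3 U := hU.of_le (WithTop.coe_le_coe.2 le_top)
  have h1 := stub_verticalVorticityDivergenceForm (α := α) hU3 hdiv y
  have h2 := stub_rotatedVorticityEq hU hP hdiv heq y
  have h3 : (Δ (curl U)) y 2 = fderiv ℝ (curl U) y (U y + (1 / 2 : ℝ) • y - α • rotGen y) 2 + curl U y 2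
      - fderiv ℝ U y (curl U y) 2 := by
    rw [h2]
    simp only [PiLp.add_apply, PiLp.sub_apply, PiLp.smul_apply, rotGen_apply_two, smul_eq_mul, mul_zero, add_zero]
  rw [h1, h3]
  ring

/-- **∫ ω₃ = 0**: for a smooth rotated Leray profile with the profile Type-I decay, the Type-I derivative decay and
`ω₃ ∈ L¹`, the vertical vorticity has ZERO TOTAL INTEGRAL (`½ω₃ = div F` and `∫ div F = 0` by
`integral_divergence_eq_zero_of_integrable_div`, the flux being admissible by V3). [folklore] -/
theorem integral_verticalVorticity_eq_zero {α C₀ K : ℝ}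
    {U : EuclideanSpace ℝ (Fin 3) → EuclideanSpace ℝ (Fin 3)} {P : EuclideanSpace ℝ (Fin 3) → ℝ}
    (hU : ContDiff ℝ (⊤ : ℕ∞) U) (hP : ContDiff ℝ (⊤ : ℕ∞) P) (hdiv : VectorCalculus.IsDivFree U)
    (heq : ∀ y : EuclideanSpace ℝ (Fin 3),
      α • (rotGen (U y) - fderiv ℝ U y (rotGen y)) + (1 / 2 : ℝ) • U y + (1 / 2 : ℝ) • fderiv ℝ U y y
        - (Δ U) y + fderiv ℝ U y (U y) + gradient P y = 0)
    (hdec : ∀ y : EuclideanSpace ℝ (Fin 3), ‖U y‖ ≤ C₀ / (1 + ‖y‖))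
    (hD1 : ∀ y : EuclideanSpace ℝ (Fin 3), ‖fderiv ℝ U y‖ ≤ K / (1 + ‖y‖) ^ 2)
    (hD2 : ∀ y : EuclideanSpace ℝ (Fin 3), ‖fderiv ℝ (curl U) y‖ ≤ K / (1 + ‖y‖) ^ 3)
    (hint : Integrable (fun y => curl U y 2)) :
    ∫ y, curl U y 2 = 0 := by
  have hU3 : ContDiff ℝ 3 U := hU.of_le (WithTop.coe_le_coe.2 le_top)
  set F : EuclideanSpace ℝ (Fin 3) → EuclideanSpace ℝ (Fin 3) := fun z =>
    (curl U z 2) • (U z + (1 / 2 : ℝ) • z - α • rotGen z) - gradient (fun w => curl U w 2) z - (U z 2) • curl U z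
    with hF
  have hdivF : ∀ y, VectorCalculus.divergence F y = (1 / 2 : ℝ) * curl U y 2 := fun y =>
    divergence_verticalVorticityFlux hU hP hdiv heq y
  have hFC1 : ContDiff ℝ 1 F := contDiff_verticalVorticityFlux hU3
  have hi : Integrable (fun y => ‖F y‖ / (1 + ‖y‖)) :=
    stub_verticalVorticityFluxIntegrable.2 α C₀ K U hU3 hdec hD1 hD2 hint
  have hfun : (fun y => VectorCalculus.divergence F y) = fun y => (1 / 2 : ℝ) * curl U y 2 := funext hdivF
  have hd : Integrable (fun y => VectorCalculus.divergence F y) := by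
    rw [hfun]
    exact hint.const_mul _
  have hzero := integral_divergence_eq_zero_of_integrable_div hFC1 hi hd
  rw [hfun, integral_const_mul] at hzero
  linarith

/-- **Assembly A1 `rotatedLerayProfile_eq_zero_of_cyclonic`** (registered theorem of crux stmt-NavierStokesRegularity-11282,
line `registered`, skeleton v13). A smooth solution of Perelman's rotated Leray profile system with the profile Type-I decay,
polynomially bounded pressure and the Type-I derivative decay, whose vertical vorticity is CYCLONIC everywhere (`α ω₃ ≥ 0`)
and integrable, is trivial: `∫ ω₃ = 0` forces the signed continuous integrable `α ω₃` to vanish identically, and then the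
co-rotation theorem (`rotatedLerayProfile_eq_zero_of_counterRotating_poly`, lead c5) applies. [cite: Tsai1998, Theorem 1 (the case α = 0)] -/
theorem rotatedLerayProfile_eq_zero_of_cyclonic {α C₀ M K : ℝ} {N : ℕ}
    {U : EuclideanSpace ℝ (Fin 3) → EuclideanSpace ℝ (Fin 3)} {P : EuclideanSpace ℝ (Fin 3) → ℝ}
    (hU : ContDiff ℝ (⊤ : ℕ∞) U) (hP : ContDiff ℝ (⊤ : ℕ∞) P) (hdiv : VectorCalculus.IsDivFree U)
    (heq : ∀ y : EuclideanSpace ℝ (Fin 3),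
      α • (rotGen (U y) - fderiv ℝ U y (rotGen y)) + (1 / 2 : ℝ) • U y + (1 / 2 : ℝ) • fderiv ℝ U y y
        - (Δ U) y + fderiv ℝ U y (U y) + gradient P y = 0)
    (hdec : ∀ y : EuclideanSpace ℝ (Fin 3), ‖U y‖ ≤ C₀ / (1 + ‖y‖))
    (hPM : ∀ y : EuclideanSpace ℝ (Fin 3), |P y| ≤ M * (1 + ‖y‖) ^ N)
    (hD1 : ∀ y : EuclideanSpace ℝ (Fin 3), ‖fderiv ℝ U y‖ ≤ K / (1 + ‖y‖) ^ 2)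
    (hD2 : ∀ y : EuclideanSpace ℝ (Fin 3), ‖fderiv ℝ (curl U) y‖ ≤ K / (1 + ‖y‖) ^ 3)
    (hint : MeasureTheory.Integrable (fun y => curl U y 2))
    (hsign : ∀ y : EuclideanSpace ℝ (Fin 3), 0 ≤ α * (curl U y) 2) : U = 0 := by
  have hI0 := integral_verticalVorticity_eq_zero hU hP hdiv heq hdec hD1 hD2 hint
  -- `α ω₃` is nonnegative, continuous, integrable, with zero integral: it vanishes identically
  have hU1 : ContDiff ℝ 1 U := hU.of_le (by exact_mod_cast le_top)
  have hωc : Continuous (curl U) := (contDiff_curl (n := 0) (by exact_mod_cast hU1)).continuous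
  have hcont : Continuous (fun y => α * curl U y 2) :=
    continuous_const.mul ((EuclideanSpace.proj (2 : Fin 3) : EuclideanSpace ℝ (Fin 3) →L[ℝ] ℝ).continuous.comp hωc)
  have hintα : Integrable (fun y => α * curl U y 2) := hint.const_mul α
  have hIα : ∫ y, α * curl U y 2 = 0 := by rw [integral_const_mul, hI0, mul_zero]
  have hae : (fun y => α * curl U y 2) =ᵐ[volume] 0 :=
    (integral_eq_zero_iff_of_nonneg (fun y => hsign y) hintα).1 hIα
  have hev : (fun y => α * curl U y 2) = fun _ => (0 : ℝ) := (hcont.ae_eq_iff_eq volume continuous_const).1 hae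
  have hsign' : ∀ y : EuclideanSpace ℝ (Fin 3), α * (curl U y) 2 ≤ 0 := fun y => (congrFun hev y).le
  exact rotatedLerayProfile_eq_zero_of_counterRotating_poly hU hP hdiv heq hdec hPM hsign'

/-- **Sign change of the vertical vorticity.** A NONTRIVIAL smooth rotated Leray profile with the profile Type-I decay,
polynomial pressure and Type-I derivative decay has a counter-rotating point (`α ω₃ < 0`) unless its vertical vorticity is
non-integrable; together with c5's `exists_corotating_vorticity_of_ne_zero` (a co-rotating point `α ω₃ > 0` always exists),
`ω₃` changes sign whenever it is integrable. [cite: Tsai1998, Theorem 1 (the case α = 0)] -/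
theorem rotatedLerayProfile_counterRotating_or_nonintegrable {α C₀ M K : ℝ} {N : ℕ}
    {U : EuclideanSpace ℝ (Fin 3) → EuclideanSpace ℝ (Fin 3)} {P : EuclideanSpace ℝ (Fin 3) → ℝ}
    (hU : ContDiff ℝ (⊤ : ℕ∞) U) (hP : ContDiff ℝ (⊤ : ℕ∞) P) (hdiv : VectorCalculus.IsDivFree U)
    (heq : ∀ y : EuclideanSpace ℝ (Fin 3),
      α • (rotGen (U y) - fderiv ℝ U y (rotGen y)) + (1 / 2 : ℝ) • U y + (1 / 2 : ℝ) • fderiv ℝ U y y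
        - (Δ U) y + fderiv ℝ U y (U y) + gradient P y = 0)
    (hdec : ∀ y : EuclideanSpace ℝ (Fin 3), ‖U y‖ ≤ C₀ / (1 + ‖y‖))
    (hPM : ∀ y : EuclideanSpace ℝ (Fin 3), |P y| ≤ M * (1 + ‖y‖) ^ N)
    (hD1 : ∀ y : EuclideanSpace ℝ (Fin 3), ‖fderiv ℝ U y‖ ≤ K / (1 + ‖y‖) ^ 2)
    (hD2 : ∀ y : EuclideanSpace ℝ (Fin 3), ‖fderiv ℝ (curl U) y‖ ≤ K / (1 + ‖y‖) ^ 3)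
    (hne : U ≠ 0) :
    (∃ y : EuclideanSpace ℝ (Fin 3), α * (curl U y) 2 < 0) ∨ ¬ MeasureTheory.Integrable (fun y => curl U y 2) := by
  by_contra h
  push Not at h
  obtain ⟨hsign, hint⟩ := h
  exact hne (rotatedLerayProfile_eq_zero_of_cyclonic hU hP hdiv heq hdec hPM hD1 hD2 hint hsign)

/-! ### A2: vorticity avoiding the OPEN co-rotation ball forces triviality -/

/-- **Assembly A2 `rotatedLerayProfile_eq_zero_of_offBall`** (registered theorem of crux stmt-NavierStokesRegularity-11282, line
`registered`, skeleton v13). A smooth solution of Perelman's rotated Leray profile system with the profile Type-I decay,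
polynomial pressure and the Type-I derivative decay, whose vorticity never enters the OPEN co-rotation ball `B(αe₃, |α|)`
(`2α ω₃ ≤ |ω|²` everywhere), is trivial: for `α = 0` this is the co-rotation theorem; for `α ≠ 0` the vorticity lies on the
sphere (`rotatedLerayProfile_vorticity_on_corotationSphere_poly`), so `ω₃ = |ω|²/(2α)` is cyclonic and integrable (V3), and A1
applies. Closes the sphere case left open by c5's `rotatedLerayProfile_vorticity_on_corotationSphere`.
[cite: Tsai1998, Theorem 1 (the case α = 0)] -/
theorem rotatedLerayProfile_eq_zero_of_offBall {α C₀ M K : ℝ} {N : ℕ}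
    {U : EuclideanSpace ℝ (Fin 3) → EuclideanSpace ℝ (Fin 3)} {P : EuclideanSpace ℝ (Fin 3) → ℝ}
    (hU : ContDiff ℝ (⊤ : ℕ∞) U) (hP : ContDiff ℝ (⊤ : ℕ∞) P) (hdiv : VectorCalculus.IsDivFree U)
    (heq : ∀ y : EuclideanSpace ℝ (Fin 3),
      α • (rotGen (U y) - fderiv ℝ U y (rotGen y)) + (1 / 2 : ℝ) • U y + (1 / 2 : ℝ) • fderiv ℝ U y y
        - (Δ U) y + fderiv ℝ U y (U y) + gradient P y = 0)
    (hdec : ∀ y : EuclideanSpace ℝ (Fin 3), ‖U y‖ ≤ C₀ / (1 + ‖y‖))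
    (hPM : ∀ y : EuclideanSpace ℝ (Fin 3), |P y| ≤ M * (1 + ‖y‖) ^ N)
    (hD1 : ∀ y : EuclideanSpace ℝ (Fin 3), ‖fderiv ℝ U y‖ ≤ K / (1 + ‖y‖) ^ 2)
    (hD2 : ∀ y : EuclideanSpace ℝ (Fin 3), ‖fderiv ℝ (curl U) y‖ ≤ K / (1 + ‖y‖) ^ 3)
    (hball : ∀ y : EuclideanSpace ℝ (Fin 3), 2 * α * (curl U y) 2 ≤ ‖curl U y‖ ^ 2) : U = 0 := by
  by_cases hα : α = 0
  · subst hα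
    exact rotatedLerayProfile_eq_zero_of_counterRotating_poly hU hP hdiv heq hdec hPM fun y => by
      rw [zero_mul]
  · have hsphere := rotatedLerayProfile_vorticity_on_corotationSphere_poly hU hP hdiv heq hdec hPM hball
    have hU2 : ContDiff ℝ 2 U := hU.of_le (WithTop.coe_le_coe.2 le_top)
    have hint : Integrable (fun y => curl U y 2) :=
      stub_verticalVorticityFluxIntegrable.1 α K U hα hU2 hD1 hsphere
    have hsign : ∀ y : EuclideanSpace ℝ (Fin 3), 0 ≤ α * (curl U y) 2 := fun y => by
      have h := hsphere y
      nlinarith [sq_nonneg ‖curl U y‖]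
    exact rotatedLerayProfile_eq_zero_of_cyclonic hU hP hdiv heq hdec hPM hD1 hD2 hint hsign

/-- **A nontrivial rotated Leray profile enters the open co-rotation ball** (contrapositive of A2): under the same data with
`U ≠ 0` there is a point with `|curl U|² < 2α (curl U)₃`, i.e. `|curl U − αe₃| < |α|` — there the vorticity is nonzero,
co-rotating (`α ω₃ > 0`) and weak (`|ω| < 2|α|`). [cite: Tsai1998, Theorem 1 (the case α = 0)] -/
theorem exists_vorticity_in_corotationBall_of_ne_zero {α C₀ M K : ℝ} {N : ℕ}
    {U : EuclideanSpace ℝ (Fin 3) → EuclideanSpace ℝ (Fin 3)} {P : EuclideanSpace ℝ (Fin 3) → ℝ}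
    (hU : ContDiff ℝ (⊤ : ℕ∞) U) (hP : ContDiff ℝ (⊤ : ℕ∞) P) (hdiv : VectorCalculus.IsDivFree U)
    (heq : ∀ y : EuclideanSpace ℝ (Fin 3),
      α • (rotGen (U y) - fderiv ℝ U y (rotGen y)) + (1 / 2 : ℝ) • U y + (1 / 2 : ℝ) • fderiv ℝ U y y
        - (Δ U) y + fderiv ℝ U y (U y) + gradient P y = 0)
    (hdec : ∀ y : EuclideanSpace ℝ (Fin 3), ‖U y‖ ≤ C₀ / (1 + ‖y‖))
    (hPM : ∀ y : EuclideanSpace ℝ (Fin 3), |P y| ≤ M * (1 + ‖y‖) ^ N)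
    (hD1 : ∀ y : EuclideanSpace ℝ (Fin 3), ‖fderiv ℝ U y‖ ≤ K / (1 + ‖y‖) ^ 2)
    (hD2 : ∀ y : EuclideanSpace ℝ (Fin 3), ‖fderiv ℝ (curl U) y‖ ≤ K / (1 + ‖y‖) ^ 3)
    (hne : U ≠ 0) :
    ∃ y : EuclideanSpace ℝ (Fin 3), ‖curl U y‖ ^ 2 < 2 * α * (curl U y) 2 := by
  by_contra h
  push Not at h
  exact hne (rotatedLerayProfile_eq_zero_of_offBall hU hP hdiv heq hdec hPM hD1 hD2 h)

/-! ### A3: the data of `RssProfileExists` -/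

/-- **Type-I derivative decay of an RSS profile.** From the data of `RssProfileExists` (stmt-NavierStokesRegularity-16274) the
profile `U = u(−1)` obeys `‖DU(x)‖ ≤ K/(1+‖x‖)²`, `‖D(curl U)(x)‖ ≤ K/(1+‖x‖)³`: `U = V(−1)` for the classical Oseen-gauge
representative `V` (`stub_rssDataClassical`), and V4 (Pineau–Vicol 2026, Lemma 7.1). [cite: PineauVicol2026, Lemma 7.1] -/
theorem rssData_derivativeDecay {α C₀ : ℝ} {U : EuclideanSpace ℝ (Fin 3) → EuclideanSpace ℝ (Fin 3)}
    {Rot : ℝ → (EuclideanSpace ℝ (Fin 3) ≃ₗᵢ[ℝ] EuclideanSpace ℝ (Fin 3))}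
    {u : ℝ → EuclideanSpace ℝ (Fin 3) → EuclideanSpace ℝ (Fin 3)}
    (hRot : ∀ θ : ℝ, Rot θ (EuclideanSpace.single 0 1) = Real.cos θ • EuclideanSpace.single 0 1 + Real.sin θ • EuclideanSpace.single 1 1 ∧
      Rot θ (EuclideanSpace.single 1 1) = -(Real.sin θ • EuclideanSpace.single 0 1) + Real.cos θ • EuclideanSpace.single 1 1 ∧
      Rot θ (EuclideanSpace.single 2 1) = EuclideanSpace.single 2 1)
    (hU2 : ContDiff ℝ 2 U) (hu1 : u (-1) = U)
    (hrss : ∀ c : ℝ, 0 < c → IsRotatedDSS c (Rot (-(α * (2 * Real.log c)))) u)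
    (hmild : IsAncientMildSolution 1 u) (hmeas : ∀ t < 0, MeasureTheory.AEStronglyMeasurable (u t) MeasureTheory.volume)
    (hC : HasTypeIDecay C₀ u) :
    ∃ K : ℝ, 0 ≤ K ∧ ∀ x : EuclideanSpace ℝ (Fin 3),
      ‖fderiv ℝ U x‖ ≤ K / (1 + ‖x‖) ^ 2 ∧ ‖fderiv ℝ (curl U) x‖ ≤ K / (1 + ‖x‖) ^ 3 := by
  obtain ⟨V, q, -, hVI, hcl, -, hV1⟩ := stub_rssDataClassical hRot hU2 hu1 hrss hmild hmeas hC
  have hIcl : ∀ t ∈ Iio (0 : ℝ), ∀ x : EuclideanSpace ℝ (Fin 3), ‖V t x‖ ≤ C₀ / (‖x‖ + Real.sqrt (-t)) :=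
    fun t ht x => hVI t ht x
  have h2 : ContDiff ℝ 2 (V (-1)) := by rw [hV1]; exact hU2
  obtain ⟨K, hK0, hK⟩ := stub_typeIDerivativeDecay hcl hIcl h2
  rw [hV1] at hK
  exact ⟨K, hK0, hK⟩

/-- **Every nontrivial RSS profile enters the open co-rotation ball**: under the data of `RssProfileExists` with `U ≠ 0` there
is a point with `|curl U|² < 2α (curl U)₃` (`rssData_rotatedLerayProfile`, `rssData_derivativeDecay`, A2).
[cite: PineauVicol2026, Conjecture 1.1 and (1.8) (arXiv:2607.09619 pp. 3–4)] -/
theorem rssData_enters_corotationBall {α C₀ : ℝ} {U : EuclideanSpace ℝ (Fin 3) → EuclideanSpace ℝ (Fin 3)}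
    {Rot : ℝ → (EuclideanSpace ℝ (Fin 3) ≃ₗᵢ[ℝ] EuclideanSpace ℝ (Fin 3))}
    {u : ℝ → EuclideanSpace ℝ (Fin 3) → EuclideanSpace ℝ (Fin 3)}
    (hRot : ∀ θ : ℝ, Rot θ (EuclideanSpace.single 0 1) = Real.cos θ • EuclideanSpace.single 0 1 + Real.sin θ • EuclideanSpace.single 1 1 ∧
      Rot θ (EuclideanSpace.single 1 1) = -(Real.sin θ • EuclideanSpace.single 0 1) + Real.cos θ • EuclideanSpace.single 1 1 ∧
      Rot θ (EuclideanSpace.single 2 1) = EuclideanSpace.single 2 1)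
    (hU2 : ContDiff ℝ 2 U) (hU0 : U ≠ 0) (hu1 : u (-1) = U)
    (hrss : ∀ c : ℝ, 0 < c → IsRotatedDSS c (Rot (-(α * (2 * Real.log c)))) u)
    (hmild : IsAncientMildSolution 1 u) (hmeas : ∀ t < 0, MeasureTheory.AEStronglyMeasurable (u t) MeasureTheory.volume)
    (hC : HasTypeIDecay C₀ u) :
    ∃ y : EuclideanSpace ℝ (Fin 3), ‖curl U y‖ ^ 2 < 2 * α * (curl U y) 2 := by
  obtain ⟨P, hU, hP, hdiv, heq, hdec, M, N, hPM⟩ := rssData_rotatedLerayProfile hRot hU2 hu1 hrss hmild hmeas hC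
  obtain ⟨K, -, hK⟩ := rssData_derivativeDecay hRot hU2 hu1 hrss hmild hmeas hC
  exact exists_vorticity_in_corotationBall_of_ne_zero hU hP hdiv heq hdec hPM (fun y => (hK y).1) (fun y => (hK y).2) hU0

/-- **The vertical vorticity of a nontrivial RSS profile changes sign or is non-integrable**: under the data of
`RssProfileExists` with `U ≠ 0`, either `α (curl U)₃ < 0` somewhere or `(curl U)₃ ∉ L¹(ℝ³)` (A1); a co-rotating point
`α (curl U)₃ > 0` exists in any case (`rssData_exists_corotating_vorticity`). [cite: PineauVicol2026, Conjecture 1.1 and (1.8) (arXiv:2607.09619 pp. 3–4)] -/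
theorem rssData_vertical_vorticity_sign_change {α C₀ : ℝ} {U : EuclideanSpace ℝ (Fin 3) → EuclideanSpace ℝ (Fin 3)}
    {Rot : ℝ → (EuclideanSpace ℝ (Fin 3) ≃ₗᵢ[ℝ] EuclideanSpace ℝ (Fin 3))}
    {u : ℝ → EuclideanSpace ℝ (Fin 3) → EuclideanSpace ℝ (Fin 3)}
    (hRot : ∀ θ : ℝ, Rot θ (EuclideanSpace.single 0 1) = Real.cos θ • EuclideanSpace.single 0 1 + Real.sin θ • EuclideanSpace.single 1 1 ∧
      Rot θ (EuclideanSpace.single 1 1) = -(Real.sin θ • EuclideanSpace.single 0 1) + Real.cos θ • EuclideanSpace.single 1 1 ∧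
      Rot θ (EuclideanSpace.single 2 1) = EuclideanSpace.single 2 1)
    (hU2 : ContDiff ℝ 2 U) (hU0 : U ≠ 0) (hu1 : u (-1) = U)
    (hrss : ∀ c : ℝ, 0 < c → IsRotatedDSS c (Rot (-(α * (2 * Real.log c)))) u)
    (hmild : IsAncientMildSolution 1 u) (hmeas : ∀ t < 0, MeasureTheory.AEStronglyMeasurable (u t) MeasureTheory.volume)
    (hC : HasTypeIDecay C₀ u) :
    (∃ y : EuclideanSpace ℝ (Fin 3), α * (curl U y) 2 < 0) ∨ ¬ MeasureTheory.Integrable (fun y => curl U y 2) := by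
  obtain ⟨P, hU, hP, hdiv, heq, hdec, M, N, hPM⟩ := rssData_rotatedLerayProfile hRot hU2 hu1 hrss hmild hmeas hC
  obtain ⟨K, -, hK⟩ := rssData_derivativeDecay hRot hU2 hu1 hrss hmild hmeas hC
  exact rotatedLerayProfile_counterRotating_or_nonintegrable hU hP hdiv heq hdec hPM (fun y => (hK y).1)
    (fun y => (hK y).2) hU0

/-- **Assembly A3 `rssProfileExists_enters_corotationBall`** (registered theorem of crux stmt-NavierStokesRegularity-11282, line
`registered`, skeleton v13). `RssProfileExists` (stmt-16274) implies: there are `α ≠ 0`, `C₀`, a smooth nontrivial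
divergence-free `U` with `‖U y‖ ≤ C₀/(1+‖y‖)` and a smooth `P` with `|P y| ≤ M(1+‖y‖)^N` solving Perelman's rotated profile
system, a point where the vorticity is STRICTLY inside the co-rotation ball `B(αe₃, |α|)` (`|curl U|² < 2α (curl U)₃`), and
either a counter-rotating point `α (curl U)₃ < 0` or a non-integrable vertical vorticity. [cite: PineauVicol2026, Conjecture 1.1 and (1.8) (arXiv:2607.09619 pp. 3–4)] -/
theorem rssProfileExists_enters_corotationBall
    (h : Summit.NavierStokesRegularity.NavierStokesRegularity.Theses.FilamentSkeletonRss.RssProfileExists) :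
    ∃ (α C₀ M : ℝ) (N : ℕ) (U : EuclideanSpace ℝ (Fin 3) → EuclideanSpace ℝ (Fin 3)) (P : EuclideanSpace ℝ (Fin 3) → ℝ),
      α ≠ 0 ∧ U ≠ 0 ∧ ContDiff ℝ (⊤ : ℕ∞) U ∧ ContDiff ℝ (⊤ : ℕ∞) P ∧ VectorCalculus.IsDivFree U ∧
      (∀ y : EuclideanSpace ℝ (Fin 3),
        α • (rotGen (U y) - fderiv ℝ U y (rotGen y)) + (1 / 2 : ℝ) • U y + (1 / 2 : ℝ) • fderiv ℝ U y y
          - (Δ U) y + fderiv ℝ U y (U y) + gradient P y = 0) ∧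
      (∀ y : EuclideanSpace ℝ (Fin 3), ‖U y‖ ≤ C₀ / (1 + ‖y‖)) ∧
      (∀ y : EuclideanSpace ℝ (Fin 3), |P y| ≤ M * (1 + ‖y‖) ^ N) ∧
      (∃ y : EuclideanSpace ℝ (Fin 3), ‖curl U y‖ ^ 2 < 2 * α * (curl U y) 2) ∧
      ((∃ y : EuclideanSpace ℝ (Fin 3), α * (curl U y) 2 < 0) ∨ ¬ MeasureTheory.Integrable (fun y => curl U y 2)) := by
  obtain ⟨α, C₀, U, Rot, u, hα, hRot, hU2, hU0, hu1, hrss, hmild, hmeas, hC⟩ := h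
  obtain ⟨P, hU, hP, hdiv, heq, hdec, M, N, hPM⟩ := rssData_rotatedLerayProfile hRot hU2 hu1 hrss hmild hmeas hC
  exact ⟨α, C₀, M, N, U, P, hα, hU0, hU, hP, hdiv, heq, hdec, hPM,
    rssData_enters_corotationBall hRot hU2 hU0 hu1 hrss hmild hmeas hC,
    rssData_vertical_vorticity_sign_change hRot hU2 hU0 hu1 hrss hmild hmeas hC⟩

/-- **Strict co-rotation necessity for the open stub, contrapositive packaging.** A Liouville theorem for smooth rotated Leray
profiles (`α ≠ 0`, Type-I profile decay, polynomial pressure) may now ASSUME the Type-I derivative decay, a point with vorticity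
strictly inside `B(αe₃, |α|)` and a counter-rotating-or-non-integrable vertical vorticity; if under these extra hypotheses
`U = 0` follows, `RssProfileExists` (stmt-16274) fails. [cite: PineauVicol2026, Conjecture 1.1 (arXiv:2607.09619 p. 3)] -/
theorem not_rssProfileExists_of_inBall_liouville
    (h : ∀ (α C₀ M K : ℝ) (N : ℕ) (U : EuclideanSpace ℝ (Fin 3) → EuclideanSpace ℝ (Fin 3)) (P : EuclideanSpace ℝ (Fin 3) → ℝ),
      α ≠ 0 → ContDiff ℝ (⊤ : ℕ∞) U → ContDiff ℝ (⊤ : ℕ∞) P → VectorCalculus.IsDivFree U →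
      (∀ y : EuclideanSpace ℝ (Fin 3),
        α • (rotGen (U y) - fderiv ℝ U y (rotGen y)) + (1 / 2 : ℝ) • U y + (1 / 2 : ℝ) • fderiv ℝ U y y
          - (Δ U) y + fderiv ℝ U y (U y) + gradient P y = 0) →
      (∀ y : EuclideanSpace ℝ (Fin 3), ‖U y‖ ≤ C₀ / (1 + ‖y‖)) →
      (∀ y : EuclideanSpace ℝ (Fin 3), |P y| ≤ M * (1 + ‖y‖) ^ N) →
      (∀ y : EuclideanSpace ℝ (Fin 3), ‖fderiv ℝ U y‖ ≤ K / (1 + ‖y‖) ^ 2) →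
      (∀ y : EuclideanSpace ℝ (Fin 3), ‖fderiv ℝ (curl U) y‖ ≤ K / (1 + ‖y‖) ^ 3) →
      (∃ y : EuclideanSpace ℝ (Fin 3), ‖curl U y‖ ^ 2 < 2 * α * (curl U y) 2) →
      ((∃ y : EuclideanSpace ℝ (Fin 3), α * (curl U y) 2 < 0) ∨ ¬ MeasureTheory.Integrable (fun y => curl U y 2)) →
      U = 0) :
    ¬ Summit.NavierStokesRegularity.NavierStokesRegularity.Theses.FilamentSkeletonRss.RssProfileExists := by
  intro hR
  obtain ⟨α, C₀, U, Rot, u, hα, hRot, hU2, hU0, hu1, hrss, hmild, hmeas, hC⟩ := hR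
  obtain ⟨P, hU, hP, hdiv, heq, hdec, M, N, hPM⟩ := rssData_rotatedLerayProfile hRot hU2 hu1 hrss hmild hmeas hC
  obtain ⟨K, -, hK⟩ := rssData_derivativeDecay hRot hU2 hu1 hrss hmild hmeas hC
  exact hU0 (h α C₀ M K N U P hα hU hP hdiv heq hdec hPM (fun y => (hK y).1) (fun y => (hK y).2)
    (rssData_enters_corotationBall hRot hU2 hU0 hu1 hrss hmild hmeas hC)
    (rssData_vertical_vorticity_sign_change hRot hU2 hU0 hu1 hrss hmild hmeas hC))

end Summit.NavierStokesRegularity.NavierStokesRegularity.Theorems.CorkscrewProfile.Birth
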